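import Literature.MathematicalPhysics.QuantumLattice.TorusSectorGibbsOpenBoxBound
import Literature.MathematicalPhysics.QuantumLattice.GibbsVariationalPrinciple
import Literature.InformationTheory.Entropy.RenyiTwoEntropyBound
import HarnessLib

/-!
# Entropy-certified box trial states: a certified lower bound on the sector pressure from the ENERGY and
# the PURITY of an arbitrary box density matrix (the "thermal box tiling" producer of the free-energy route)

Family `hubbard` (topic `MathematicalPhysics/QuantumLattice`). The free-energy route needs certified LOWER
bounds `ℓ L² ≤ log Z_β^{sector}(L)` carrying ENTROPY. `TorusSectorGibbsOpenBoxBound.lean` reads them from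
a certified floor `z ≤ Re Z_β(H^open_{a×a}; a₀, a₀)` of an open-box canonical partition function. Here the floor
is produced from ANY density matrix `ρ` on the box sector — e.g. a matrix-product density operator from
finite-temperature DMRG, whose energy `Re tr(ρ H^open)` and purity `Re tr(ρ²)` are exact rational
contractions — by the Gibbs variational principle and the Rényi-2 bound `S(ρ) ≥ −log tr(ρ²)`:

* `exp_neg_log_purity_sub_mul_energy_le_partitionFn` — `exp(−log P − β E) ≤ Re Z_β(H)` whenever
  `Re tr(ρ H) ≤ E` and `Re tr(ρ²) ≤ P` for a density `ρ` (any Hermitian `H`, `β ≥ 0`);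
* `IsTorusLimitOfMixture.meanEnergy_hubbardTTPrime_le_chord_of_purityBox` — for every torus limit `ω` of the
  canonical sector Gibbs states at `β` along box-built tori (`Ls j = K_j a`, `halfRectN n (Ls j) = K_j² a₀`),
  every box density `ρ` on the sector `(a₀, a₀)` of `H^open_{a×a}(t,t',U)` with certified `E`, `P`, and every
  eventual hot bound `log Z_{β_h}^{sector} ≤ u_h L²` (`0 < β_h < β`):
  `e_Φ(ω) ≤ (u_h + (log P + β E)/a²)/(β − β_h)` — entropy in the cold anchor, the lever both `T > 0`
  producers of the `hubbard-thermal` programme are bottlenecked on.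

[cite: Israel1979, Lemma II.3.1] (Gibbs variational principle); [cite: NielsenChuang2010, §11.3 Exercise 11.12]
(Rényi monotonicity); [cite: Ruelle1969, §3.3] (sub-box trial states). Everything is PROVED; no definition,
no named fact.
-/

noncomputable section

namespace Literature.MathematicalPhysics.QuantumLattice

open Matrix Finset HubbardWave0 ThermodynamicLimit LiebThm1 Literature.Probability.LatticeModels
open Literature.InformationTheory.Entropy (vonNeumannEntropy)
open _root_.Filter
open scoped _root_.Topology ComplexOrder BigOperators

/-! ### §1 Energy + purity ⇒ a partition-function floor -/

/-- **A trial density with certified energy and purity floors the partition function**: for a Hermitian `H`,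
`β ≥ 0` and a density matrix `ρ` with `Re tr(ρ H) ≤ E` and `Re tr(ρ²) ≤ P`:
`exp(−log P − β E) ≤ Re Z_β(H)` (Gibbs variational principle `S(ρ) − β⟨H⟩_ρ ≤ log Z_β` with
`S(ρ) ≥ −log tr ρ²`). [cite: Israel1979, Lemma II.3.1] [cite: NielsenChuang2010, §11.3 Exercise 11.12] -/
theorem exp_neg_log_purity_sub_mul_energy_le_partitionFn {m : Type*} [Fintype m] [DecidableEq m]
    {H : Matrix m m ℂ} (hH : H.IsHermitian) {β : ℝ} (hβ : 0 ≤ β) {ρ : Matrix m m ℂ} (hρ : ρ.PosSemidef)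
    (htr : ρ.trace = 1) {E P : ℝ} (hE : (ρ * H).trace.re ≤ E) (hP : (ρ * ρ).trace.re ≤ P) :
    Real.exp (-Real.log P - β * E) ≤ (partitionFn β H).re := by
  haveI : Nonempty m := by
    by_contra h
    rw [not_nonempty_iff] at h
    have : ρ.trace = 0 := by simp [Matrix.trace]
    rw [htr] at this
    exact one_ne_zero this
  have hGVP := hH.vonNeumannEntropy_sub_mul_le_log_partitionFn β hρ htr
  have hS := Literature.InformationTheory.Entropy.neg_log_le_vonNeumannEntropy_of_trace_sq_le hρ htr hP
  have hZpos : 0 < (partitionFn β H).re := by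
    have h0 := (Complex.lt_def.1 (partitionFn_pos β hH)).1
    simpa using h0
  have hle : -Real.log P - β * E ≤ Real.log (partitionFn β H).re := by
    have : β * (ρ * H).trace.re ≤ β * E := mul_le_mul_of_nonneg_left hE hβ
    linarith
  calc Real.exp (-Real.log P - β * E) ≤ Real.exp (Real.log (partitionFn β H).re) := Real.exp_le_exp.2 hle
    _ = (partitionFn β H).re := Real.exp_log hZpos

/-! ### §2 The certified upper edge from a purity-certified box state -/

namespace InfVolFermionState

variable {t t' U n β : ℝ} {ω : InfVolFermionState 2} {Ls : ℕ → ℕ}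

/-- **Certified upper edge of the thermal energy window from an entropy-certified box state.** Let `ω` be a
torus limit of the canonical sector Gibbs states of the `t–t'` Hubbard model at `β` along box-built tori
(`Ls j = K_j a`, `K_j ≥ 2`, `halfRectN n (Ls j) = K_j² a₀`; `a ≥ 1`, `a₀ ≤ a²`), let `ρ` be ANY density
matrix on the sector `(a₀, a₀)` of the open box `H^open_{a×a}(t,t',U)` with certified energy
`Re tr(ρ H^open|_{(a₀,a₀)}) ≤ E` and purity `Re tr(ρ²) ≤ P`, and let `log Z_{β_h}^{sector}(Ls j) ≤ u_h (Ls j)²`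
eventually for some `0 < β_h < β`. Then `e_Φ(ω) ≤ (u_h + (log P + β E)/a²)/(β − β_h)`.
[cite: Israel1979, Lemma II.3.1] [cite: Ruelle1969, §3.3] [cite: NielsenChuang2010, §11.3 Exercise 11.12] -/
theorem IsTorusLimitOfMixture.meanEnergy_hubbardTTPrime_le_chord_of_purityBox
    (hn0 : 0 ≤ n) (hn2 : n ≤ 2)
    (h : ω.IsTorusLimitOfMixture (sectorGibbsCount n) (fun L => sectorGibbsWeightTT' β t t' U n L)
      (fun L => sectorGibbsVectorTT' t t' U n L) Ls)
    (hLs : Tendsto Ls atTop atTop) {βh : ℝ} (hβh : 0 < βh) (hlt : βh < β)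
    {a a₀ : ℕ} (ha : 1 ≤ a) (ha₀ : a₀ ≤ a * a)
    {ρ : Matrix (Subtype (spinConfig (Λ := Fin a ×ₗ Fin a) a₀ a₀)) (Subtype (spinConfig (Λ := Fin a ×ₗ Fin a) a₀ a₀)) ℂ}
    (hρ : ρ.PosSemidef) (htr : ρ.trace = 1) {E P : ℝ}
    (hE : (ρ * spinSectorHamiltonian a₀ a₀ (hubbardOpenBoxTT' a a t t' U)).trace.re ≤ E)
    (hP : (ρ * ρ).trace.re ≤ P)
    (hbox : ∀ᶠ j in atTop, ∃ K, 2 ≤ K ∧ Ls j = K * a ∧ halfRectN n (Ls j) = K * K * a₀) {uh : ℝ}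
    (huh : ∀ᶠ j in atTop, Real.log (partitionFn βh (sectorHamiltonianTT' t t' U n (Ls j))).re ≤
      uh * (Ls j : ℝ) ^ 2) :
    ω.meanEnergy (hubbardTTPrimeFermionInteraction t t' U) 1 ≤
      (uh + (Real.log P + β * E) / (a : ℝ) ^ 2) / (β - βh) := by
  have hβ : 0 ≤ β := (hβh.trans hlt).le
  have hH : (spinSectorHamiltonian a₀ a₀ (hubbardOpenBoxTT' a a t t' U)).IsHermitian :=
    isHermitian_spinSectorHamiltonian a₀ a₀ (hubbardOpenBoxTT'_isHermitian a a t t' U)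
  have hz := exp_neg_log_purity_sub_mul_energy_le_partitionFn hH hβ hρ htr hE hP
  have hmain := h.meanEnergy_hubbardTTPrime_le_chord_openBox_of_sectorGibbs hn0 hn2 hLs hβh hlt ha ha₀
    (Real.exp_pos _) hz hbox huh
  rw [Real.log_exp] at hmain
  refine hmain.trans (le_of_eq ?_)
  congr 1
  ring

end InfVolFermionState

end Literature.MathematicalPhysics.QuantumLattice

end
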